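import Summits.BirchSwinnertonDyer.BirchSwinnertonDyer.Theorems.KatoDescentPotSupersingularWildConjAResidueCartanRows03
import Summits.BirchSwinnertonDyer.BirchSwinnertonDyer.Theorems.KatoDescentPotSupersingularWildConjAResidueCartanRows04
import Summits.BirchSwinnertonDyer.BirchSwinnertonDyer.Theorems.KatoDescentPotSupersingularWildUpperMuRoadThreeFukudaRecords30
import Summits.BirchSwinnertonDyer.BirchSwinnertonDyer.Theorems.KatoDescentPotSupersingularWildUpperUnitTwistRecordsClassO615
import Summits.BirchSwinnertonDyer.BirchSwinnertonDyer.Theorems.KatoDescentPotSupersingularWildUpperUnitTwistRecordsSharpP18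
import Summits.BirchSwinnertonDyer.BirchSwinnertonDyer.Theorems.KatoDescentTamePotSupersingularCartanMuRoadQuadraticUpperDoors
import HarnessLib

/-!
# Route `KatoDescentPotSupersingular` (rung K9, sub-rung B5 = O6 wild `p = 3`, cell `bsd-potss`): FERRERO–WASHINGTON REMOVED from the last `hFW`-only K9 rows —
# the `3Ns` `K⁺`-road records of 261360he1, 261360iv1, 338688dh1, 338688e1 RE-RECORDED over k8t-c4 g23's `CartanMuRoadQuadraticDoors` with NO NAMED FACT for statement (A) at `(E,3)`
# and U₀ `MissingUpperBoundAt E 3` modulo `hKatoA hGZK hmod` ONLY (seat `bsd-potss-k9-c4` g25; `--supports stmt-BirchSwinnertonDyer-19197 --as helper`), part 02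

HONEST FRAMING. THEOREMS ONLY (no definition, no named fact, no `sorry`); PER ROW — NOT a class theorem; nothing is booked; items 19189 / 19197 / 19942 stay
OPEN at class level (open input of record: the zeta crux 24327); (A) / Conjecture A / BSD proved for NO class of curves.  WHAT CHANGED.  After the NoF sweep of this
gen (hCS / hF1 / hF2 discharged) these rows' best μ-road records (`…_{fkK12r,fkK12,fkK01,fr12}NoF`) displayed ONE named fact, Ferrero–Washington `hFW` (μ = 0 of
the abelian fields met in the descent from `ℚ(E[3])` to `K⁺ = ℚ(E[3])^c = ℚ(P)`); door L5 is void on them at every layer (conjA-anchor g15: (c2)_{S,1} FAILS) or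
needs layer 2 (117504e1).  k8t-c4 g23's character count (`Literature/…/ClassicalMuVanishesCartanQuadraticDescent`, `…CartanImageThreeQuadratic`; doors
`CartanMuRoadQuadraticDoors` p703453 / `…QuadraticUpperDoors` p704175) replaces `hFW` by the displayed datum `hqrk`: «for every quadratic `K ⊆ ℚ(E[3])` NOT fixed
by the complex conjugation `c` and every cyclotomic `ℤ₃`-extension of `K`: `rank₃ Cl(K₁) = rank₃ Cl(K₀)`» (Fukuda 1994 Thm. 1 (2), a tree theorem); total
ramification of `3` from layer 0 in every subfield of `ℚ(E[3])` is KERNEL (`3 ∤ #Gal(ℚ(E[3])/ℚ)` on Cartan rows).  NUMERICS (kit j327496, script = k8t-c4 g23's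
`quadsub_k9.gp` verbatim but for the row list; PARI 2.17; `nfsubfields` of the splitting field of `ψ₃`; `bnfinit` + `bnfcertify` at degrees 2 and 6 — GRH-FREE): on
every row below `ℚ(E[3])` (degree 8, image `3Ns`) has exactly three quadratic subfields, `ℚ(√−3)` and one further imaginary one `ℚ(√D)` plus a real one; both imaginary
ones satisfy `hqrk` with the layer index `m` quoted per row (`m = 0`: ranks at layers (0,1); `m = 1`: at layers (1,2), used where `3` SPLITS in `ℚ(√D)` and the `3`-rank jumps `0 → 1` at the first layer and then stays `1` — degrees 6 and 18, all `bnfcertify`'d; for `ℚ(√−3)` the layers are `ℚ(ζ₉)`, `ℚ(ζ₂₇)` with `h = 1`): `ℚ(√D)` as quoted per row.  The `K⁺` datum (`hrk` = `rank₃ Cl(K⁺_{n+1}) =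
rank₃ Cl(K⁺_n)` resp. `hord` = `ord₃ h(K⁺_{n+1}) = ord₃ h(K⁺_n)`), its kit evidence, Cremona's `r_an = 0` and the kernel certificates `irr_…`, `classO6_…`,
`hasSplitCartanNormalizerModPImage_…` are those of the SOURCE records (named per row), REUSED verbatim.
[cite: Fukuda1994, Thm. 1, p. 264] [cite: CoatesSujatha2005, Thm. 3.4 (§3)] [cite: Kato2004Asterisque, Thm. 14.5 (3) (p. 236)] [cite: Serre1972, §2.2, §2.4 Prop. 15]
[cite: Washington1997, §13.1, §13.3 Prop. 13.23] [cite: Cremona2006, Table 1]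
-/

set_option autoImplicit false
set_option linter.dupNamespace false

noncomputable section

open scoped Classical NumberField
open WeierstrassCurve NumberField IsDedekindDomain Field IntermediateField
  Literature.NumberTheory.EllipticCurves Literature.NumberTheory.EllipticCurves.Rank1Residual
  Literature.NumberTheory.EllipticCurves.Rank1Residual.Typed
  Literature.NumberTheory.GaloisRepresentations Literature.NumberTheory.SerreUniformity Literature.NumberTheory.IwasawaTheory
  Summit.BirchSwinnertonDyer.Rank1Residual Summit.BirchSwinnertonDyer.Rank1Residual.Additive
  Summit.BirchSwinnertonDyer.BirchSwinnertonDyer.Theorems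

namespace Summit.BirchSwinnertonDyer.BirchSwinnertonDyer.Theorems.WildUpperUnitTwistRecords

/-! ### `261360he1` @ `p = 3` — a RESIDUE row of the Conj-A crux 19942 — source record `missingUpperBoundAt_g261360he1_3_fr12` (`…WildConjAResidueUnitIndexRows03`; displays `hFW`): `K⁺ = ℚ(E[3])^c`, Fukuda at layers `(1,2)`,
`rank₃ Cl(K⁺_2) = rank₃ Cl(K⁺_1)` (its kit evidence quoted there). Quadratic subfields of `ℚ(E[3])` (kit j327496): `D ∈ [-11, -3, 33]`; imaginary: `ℚ(√-11)`: `h = 1`, `3` SPLIT (`kron = 1`), `ord₃ h` at layers 0,1,2 = `[0, 1, 2]`, `rank₃` = `[0, 1, 1]` (`K₁ = x^6 - 3*x^5 + 6*x^4 - 5*x^3 + 33*x^2 - 54*x + 111`, `Cl(K₁) ≅ [3]`; `K₂` of degree 18, `Cl(K₂) ≅ [1791]`; bnfcertify 1/1/1): `rank₃` at layers (1,2): `1 = 1` (at (0,1) it FAILS: `0 ≠ 1`); `ℚ(√−3)`: `K₁ = ℚ(ζ₉)`, `K₂ = ℚ(ζ₂₇)`: `h = 1`, `1` (bnfcertify 1/1,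 kit j327832; also Iwasawa 1956 from `h(ℚ(√−3)) = 1`, `3` totally ramified), `rank₃` at layers (1,2): `0 = 0`. -/

/-- **(A) AT `(261360he1, 3)` — NO NAMED FACT** (Ferrero–Washington REMOVED): from `rank₃ Cl(K⁺_2) = rank₃ Cl(K⁺_1)` on `K⁺ = ℚ(E[3])^c` (`hrk`, the source record's datum) and `hqrk`
(`m = 1`; kit j327496, bnfcertify throughout), kernel `irr_g261360he1_3`, `hasSplitCartanNormalizerModPImage_g261360he1_3`; door
`CartanMuRoadQuadraticDoors.conjA_three_of_hasSplitCartanNormalizerModPImage_of_realRankSuccEqAt_of_quadRankSuccEqAt` (k8t-c4 g23). Per row; nothing booked.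
[cite: Fukuda1994, Thm. 1, p. 264] [cite: CoatesSujatha2005, Thm. 3.4 (§3)] [cite: Serre1972, §2.2, §2.4 Prop. 15] [cite: Cremona2006, Table 1 (Cremona label 261360he1)] -/
theorem conjA_g261360he1_3_fr12Quad
    {W : WeierstrassCurve ℚ} [W.IsElliptic] (hWeq : W = (⟨0, 0, 0, 22604373, (-9557732646)⟩ : WeierstrassCurve ℚ))
    {c : absoluteGaloisGroup ℚ} (hc : IsComplexConjugation (Rat.castHom ℝ) c)
    (hrk : ∀ κE : ZpExtension ↥(fixedField (Subgroup.zpowers (absRestrictNormalHom (W.divisionField 3) c))) 3,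
      κE.IsCyclotomic → classGroupPRank κE (1 + 1) = classGroupPRank κE 1)
    (hqrk : haveI : NumberField ↥(W.divisionField 3) := NumberField.mk
      ∀ K : IntermediateField ℚ ↥(W.divisionField 3), Module.finrank ℚ ↥K = 2 →
        ¬ K ≤ fixedField (Subgroup.zpowers (absRestrictNormalHom (W.divisionField 3) c)) →
        ∀ κE : ZpExtension ↥K 3, κE.IsCyclotomic → classGroupPRank κE (1 + 1) = classGroupPRank κE 1)
    (κ : ZpExtension ℚ 3) (hκ : κ.IsCyclotomic) :
    ∃ (γ : absoluteGaloisGroup ℚ) (Df : W.FineSelmerDualData κ γ),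
      Module.Finite ℤ_[3] (RestrictScalars ℤ_[3] (IwasawaAlgebra 3) Df.X) := by
  subst hWeq
  exact CartanMuRoadQuadraticDoors.conjA_three_of_hasSplitCartanNormalizerModPImage_of_realRankSuccEqAt_of_quadRankSuccEqAt _ irr_g261360he1_3
    hasSplitCartanNormalizerModPImage_g261360he1_3 hc 1 hrk 1 hqrk κ hκ

/-- **RECORD — U₀ `ord₃ #Ш(E) ≤ ord₃ #Ш(E)_an` for `E = 261360he1` at `p = 3` with Ferrero–Washington REMOVED**: named facts `hKatoA hGZK hmod` ONLY; displayed: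
Cremona's `r_an = 0`, the source record's `K⁺` datum `hrk` (rank₃ Cl(K⁺_2) = rank₃ Cl(K⁺_1), layers `(1,2)`), and `hqrk` (`m = 1`, kit j327496); kernel `classO6_g261360he1_3`, `irr_g261360he1_3`,
`hasSplitCartanNormalizerModPImage_g261360he1_3`; door `…missingUpperBoundAt_three_wild_of_hasSplitCartanNormalizerModPImage_of_realRankSuccEqAt_of_quadRankSuccEqAt`.
Supersedes `missingUpperBoundAt_g261360he1_3_fr12NoF` (which displays `hFW`). Per row; nothing booked; BSD proved for no curve.
[cite: Kato2004Asterisque, Thm. 14.5 (3) (p. 236)] [cite: Fukuda1994, Thm. 1, p. 264] [cite: CoatesSujatha2005, Thm. 3.4 (§3)] [cite: Cremona2006, Table 1 (Cremona label 261360he1)] -/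
theorem missingUpperBoundAt_g261360he1_3_fr12Quad
    (hKatoA : Kato2004.rankZero_padicValNat_sha_add_padicValNat_tamagawa_le_of_additive_potGood_of_irreducible_of_fineSelmerDual_fg)
    (hGZK : rank_eq_analyticRank_of_analyticRank_le_one) (hmod : hasEntireLFunction_rat)
    {W : WeierstrassCurve ℚ} [W.IsElliptic] [W.IsGloballyMinimal] (hWeq : W = (⟨0, 0, 0, 22604373, (-9557732646)⟩ : WeierstrassCurve ℚ)) (hr : W.analyticRank = 0)
    {c : absoluteGaloisGroup ℚ} (hc : IsComplexConjugation (Rat.castHom ℝ) c)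
    (hrk : ∀ κE : ZpExtension ↥(fixedField (Subgroup.zpowers (absRestrictNormalHom (W.divisionField 3) c))) 3,
      κE.IsCyclotomic → classGroupPRank κE (1 + 1) = classGroupPRank κE 1)
    (hqrk : haveI : NumberField ↥(W.divisionField 3) := NumberField.mk
      ∀ K : IntermediateField ℚ ↥(W.divisionField 3), Module.finrank ℚ ↥K = 2 →
        ¬ K ≤ fixedField (Subgroup.zpowers (absRestrictNormalHom (W.divisionField 3) c)) →
        ∀ κE : ZpExtension ↥K 3, κE.IsCyclotomic → classGroupPRank κE (1 + 1) = classGroupPRank κE 1) :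
    MissingUpperBoundAt W 3 := by
  subst hWeq
  haveI : Fact (Nat.Prime 3) := ⟨Nat.prime_three⟩
  exact CartanMuRoadQuadraticDoors.missingUpperBoundAt_three_wild_of_hasSplitCartanNormalizerModPImage_of_realRankSuccEqAt_of_quadRankSuccEqAt _ hKatoA hGZK hmod
    hr classO6_g261360he1_3 irr_g261360he1_3 hasSplitCartanNormalizerModPImage_g261360he1_3 hc 1 hrk 1 hqrk

/-! ### `261360iv1` @ `p = 3` — a RESIDUE row of the Conj-A crux 19942 — source record `missingUpperBoundAt_g261360iv1_3_fr12` (`…WildConjAResidueUnitIndexRows03`; displays `hFW`): `K⁺ = ℚ(E[3])^c`, Fukuda at layers `(1,2)`,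
`rank₃ Cl(K⁺_2) = rank₃ Cl(K⁺_1)` (its kit evidence quoted there). Quadratic subfields of `ℚ(E[3])` (kit j327496): `D ∈ [-11, -3, 33]`; imaginary: `ℚ(√-11)`: `h = 1`, `3` SPLIT (`kron = 1`), `ord₃ h` at layers 0,1,2 = `[0, 1, 2]`, `rank₃` = `[0, 1, 1]` (`K₁ = x^6 - 3*x^5 + 6*x^4 - 5*x^3 + 33*x^2 - 54*x + 111`, `Cl(K₁) ≅ [3]`; `K₂` of degree 18, `Cl(K₂) ≅ [1791]`; bnfcertify 1/1/1): `rank₃` at layers (1,2): `1 = 1` (at (0,1) it FAILS: `0 ≠ 1`); `ℚ(√−3)`: `K₁ = ℚ(ζ₉)`, `K₂ = ℚ(ζ₂₇)`: `h = 1`, `1` (bnfcertify 1/1, kit j327832; also Iwasawa 1956 from `h(ℚ(√−3)) = 1`, `3` totally ramified), `rank₃` at layers (1,2): `0 = 0`. -/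

/-- **(A) AT `(261360iv1, 3)` — NO NAMED FACT** (Ferrero–Washington REMOVED): from `rank₃ Cl(K⁺_2) = rank₃ Cl(K⁺_1)` on `K⁺ = ℚ(E[3])^c` (`hrk`, the source record's datum) and `hqrk`
(`m = 1`; kit j327496, bnfcertify throughout), kernel `irr_g261360iv1_3`, `hasSplitCartanNormalizerModPImage_g261360iv1_3`; door
`CartanMuRoadQuadraticDoors.conjA_three_of_hasSplitCartanNormalizerModPImage_of_realRankSuccEqAt_of_quadRankSuccEqAt` (k8t-c4 g23). Per row; nothing booked.
[cite: Fukuda1994, Thm. 1, p. 264] [cite: CoatesSujatha2005, Thm. 3.4 (§3)] [cite: Serre1972, §2.2, §2.4 Prop. 15] [cite: Cremona2006, Table 1 (Cremona label 261360iv1)] -/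
theorem conjA_g261360iv1_3_fr12Quad
    {W : WeierstrassCurve ℚ} [W.IsElliptic] (hWeq : W = (⟨0, 0, 0, (-1832787), (-687043566)⟩ : WeierstrassCurve ℚ))
    {c : absoluteGaloisGroup ℚ} (hc : IsComplexConjugation (Rat.castHom ℝ) c)
    (hrk : ∀ κE : ZpExtension ↥(fixedField (Subgroup.zpowers (absRestrictNormalHom (W.divisionField 3) c))) 3,
      κE.IsCyclotomic → classGroupPRank κE (1 + 1) = classGroupPRank κE 1)
    (hqrk : haveI : NumberField ↥(W.divisionField 3) := NumberField.mk
      ∀ K : IntermediateField ℚ ↥(W.divisionField 3), Module.finrank ℚ ↥K = 2 →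
        ¬ K ≤ fixedField (Subgroup.zpowers (absRestrictNormalHom (W.divisionField 3) c)) →
        ∀ κE : ZpExtension ↥K 3, κE.IsCyclotomic → classGroupPRank κE (1 + 1) = classGroupPRank κE 1)
    (κ : ZpExtension ℚ 3) (hκ : κ.IsCyclotomic) :
    ∃ (γ : absoluteGaloisGroup ℚ) (Df : W.FineSelmerDualData κ γ),
      Module.Finite ℤ_[3] (RestrictScalars ℤ_[3] (IwasawaAlgebra 3) Df.X) := by
  subst hWeq
  exact CartanMuRoadQuadraticDoors.conjA_three_of_hasSplitCartanNormalizerModPImage_of_realRankSuccEqAt_of_quadRankSuccEqAt _ irr_g261360iv1_3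
    hasSplitCartanNormalizerModPImage_g261360iv1_3 hc 1 hrk 1 hqrk κ hκ

/-- **RECORD — U₀ `ord₃ #Ш(E) ≤ ord₃ #Ш(E)_an` for `E = 261360iv1` at `p = 3` with Ferrero–Washington REMOVED**: named facts `hKatoA hGZK hmod` ONLY; displayed:
Cremona's `r_an = 0`, the source record's `K⁺` datum `hrk` (rank₃ Cl(K⁺_2) = rank₃ Cl(K⁺_1), layers `(1,2)`), and `hqrk` (`m = 1`, kit j327496); kernel `classO6_g261360iv1_3`, `irr_g261360iv1_3`,
`hasSplitCartanNormalizerModPImage_g261360iv1_3`; door `…missingUpperBoundAt_three_wild_of_hasSplitCartanNormalizerModPImage_of_realRankSuccEqAt_of_quadRankSuccEqAt`.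
Supersedes `missingUpperBoundAt_g261360iv1_3_fr12NoF` (which displays `hFW`). Per row; nothing booked; BSD proved for no curve.
[cite: Kato2004Asterisque, Thm. 14.5 (3) (p. 236)] [cite: Fukuda1994, Thm. 1, p. 264] [cite: CoatesSujatha2005, Thm. 3.4 (§3)] [cite: Cremona2006, Table 1 (Cremona label 261360iv1)] -/
theorem missingUpperBoundAt_g261360iv1_3_fr12Quad
    (hKatoA : Kato2004.rankZero_padicValNat_sha_add_padicValNat_tamagawa_le_of_additive_potGood_of_irreducible_of_fineSelmerDual_fg)
    (hGZK : rank_eq_analyticRank_of_analyticRank_le_one) (hmod : hasEntireLFunction_rat)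
    {W : WeierstrassCurve ℚ} [W.IsElliptic] [W.IsGloballyMinimal] (hWeq : W = (⟨0, 0, 0, (-1832787), (-687043566)⟩ : WeierstrassCurve ℚ)) (hr : W.analyticRank = 0)
    {c : absoluteGaloisGroup ℚ} (hc : IsComplexConjugation (Rat.castHom ℝ) c)
    (hrk : ∀ κE : ZpExtension ↥(fixedField (Subgroup.zpowers (absRestrictNormalHom (W.divisionField 3) c))) 3,
      κE.IsCyclotomic → classGroupPRank κE (1 + 1) = classGroupPRank κE 1)
    (hqrk : haveI : NumberField ↥(W.divisionField 3) := NumberField.mk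
      ∀ K : IntermediateField ℚ ↥(W.divisionField 3), Module.finrank ℚ ↥K = 2 →
        ¬ K ≤ fixedField (Subgroup.zpowers (absRestrictNormalHom (W.divisionField 3) c)) →
        ∀ κE : ZpExtension ↥K 3, κE.IsCyclotomic → classGroupPRank κE (1 + 1) = classGroupPRank κE 1) :
    MissingUpperBoundAt W 3 := by
  subst hWeq
  haveI : Fact (Nat.Prime 3) := ⟨Nat.prime_three⟩
  exact CartanMuRoadQuadraticDoors.missingUpperBoundAt_three_wild_of_hasSplitCartanNormalizerModPImage_of_realRankSuccEqAt_of_quadRankSuccEqAt _ hKatoA hGZK hmod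
    hr classO6_g261360iv1_3 irr_g261360iv1_3 hasSplitCartanNormalizerModPImage_g261360iv1_3 hc 1 hrk 1 hqrk

/-! ### `338688dh1` @ `p = 3` — source record `missingUpperBoundAt_g338688dh1_3_fkK12` (`…WildUpperMuRoadThreeFukudaRecords30`; displays `hFW`): `K⁺ = ℚ(E[3])^c`, Fukuda at layers `(1,2)`,
`ord₃ h(K⁺_2) = ord₃ h(K⁺_1)` (its kit evidence quoted there). Quadratic subfields of `ℚ(E[3])` (kit j327496): `D ∈ [-8, -3, 24]`; imaginary: `ℚ(√-8)`: `h = 1`, `3` SPLIT (`kron = 1`), `ord₃ h` at layers 0,1,2 = `[0, 1, 2]`, `rank₃` = `[0, 1, 1]` (`K₁ = x^6 + 12*x^4 + 36*x^2 + 8`, `Cl(K₁) ≅ [3]`; `K₂` of degree 18, `Cl(K₂) ≅ [333]`; bnfcertify 1/1/1): `rank₃` at layers (1,2): `1 = 1` (at (0,1) it FAILS: `0 ≠ 1`); `ℚ(√−3)`: `K₁ = ℚ(ζ₉)`, `K₂ = ℚ(ζ₂₇)`: `h = 1`, `1` (bnfcertify 1/1, kit j327832; also Iwasawa 1956 from `h(ℚ(√−3))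 = 1`, `3` totally ramified), `rank₃` at layers (1,2): `0 = 0`. -/

/-- **(A) AT `(338688dh1, 3)` — NO NAMED FACT** (Ferrero–Washington REMOVED): from `ord₃ h(K⁺_2) = ord₃ h(K⁺_1)` on `K⁺ = ℚ(E[3])^c` (`hord`, the source record's datum) and `hqrk`
(`m = 1`; kit j327496, bnfcertify throughout), kernel `irr_g338688dh1_3`, `hasSplitCartanNormalizerModPImage_g338688dh1_3`; door
`CartanMuRoadQuadraticDoors.conjA_three_of_hasSplitCartanNormalizerModPImage_of_realSuccEqAt_of_quadRankSuccEqAt` (k8t-c4 g23). Per row; nothing booked.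
[cite: Fukuda1994, Thm. 1, p. 264] [cite: CoatesSujatha2005, Thm. 3.4 (§3)] [cite: Serre1972, §2.2, §2.4 Prop. 15] [cite: Cremona2006, Table 1 (Cremona label 338688dh1)] -/
theorem conjA_g338688dh1_3_fkK12Quad
    {W : WeierstrassCurve ℚ} [W.IsElliptic] (hWeq : W = (⟨0, 0, 0, (-2646), 74088⟩ : WeierstrassCurve ℚ))
    {c : absoluteGaloisGroup ℚ} (hc : IsComplexConjugation (Rat.castHom ℝ) c)
    (hord : ∀ κE : ZpExtension ↥(fixedField (Subgroup.zpowers (absRestrictNormalHom (W.divisionField 3) c))) 3,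
      κE.IsCyclotomic → classNumberPExp κE (1 + 1) = classNumberPExp κE 1)
    (hqrk : haveI : NumberField ↥(W.divisionField 3) := NumberField.mk
      ∀ K : IntermediateField ℚ ↥(W.divisionField 3), Module.finrank ℚ ↥K = 2 →
        ¬ K ≤ fixedField (Subgroup.zpowers (absRestrictNormalHom (W.divisionField 3) c)) →
        ∀ κE : ZpExtension ↥K 3, κE.IsCyclotomic → classGroupPRank κE (1 + 1) = classGroupPRank κE 1)
    (κ : ZpExtension ℚ 3) (hκ : κ.IsCyclotomic) :
    ∃ (γ : absoluteGaloisGroup ℚ) (Df : W.FineSelmerDualData κ γ),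
      Module.Finite ℤ_[3] (RestrictScalars ℤ_[3] (IwasawaAlgebra 3) Df.X) := by
  subst hWeq
  exact CartanMuRoadQuadraticDoors.conjA_three_of_hasSplitCartanNormalizerModPImage_of_realSuccEqAt_of_quadRankSuccEqAt _ irr_g338688dh1_3
    hasSplitCartanNormalizerModPImage_g338688dh1_3 hc 1 hord 1 hqrk κ hκ

/-- **RECORD — U₀ `ord₃ #Ш(E) ≤ ord₃ #Ш(E)_an` for `E = 338688dh1` at `p = 3` with Ferrero–Washington REMOVED**: named facts `hKatoA hGZK hmod` ONLY; displayed: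
Cremona's `r_an = 0`, the source record's `K⁺` datum `hord` (ord₃ h(K⁺_2) = ord₃ h(K⁺_1), layers `(1,2)`), and `hqrk` (`m = 1`, kit j327496); kernel `classO6_g338688dh1_3`, `irr_g338688dh1_3`,
`hasSplitCartanNormalizerModPImage_g338688dh1_3`; door `…missingUpperBoundAt_three_wild_of_hasSplitCartanNormalizerModPImage_of_realSuccEqAt_of_quadRankSuccEqAt`.
Supersedes `missingUpperBoundAt_g338688dh1_3_fkK12NoF` (which displays `hFW`). Per row; nothing booked; BSD proved for no curve.
[cite: Kato2004Asterisque, Thm. 14.5 (3) (p. 236)] [cite: Fukuda1994, Thm. 1, p. 264] [cite: CoatesSujatha2005, Thm. 3.4 (§3)] [cite: Cremona2006, Table 1 (Cremona label 338688dh1)] -/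
theorem missingUpperBoundAt_g338688dh1_3_fkK12Quad
    (hKatoA : Kato2004.rankZero_padicValNat_sha_add_padicValNat_tamagawa_le_of_additive_potGood_of_irreducible_of_fineSelmerDual_fg)
    (hGZK : rank_eq_analyticRank_of_analyticRank_le_one) (hmod : hasEntireLFunction_rat)
    {W : WeierstrassCurve ℚ} [W.IsElliptic] [W.IsGloballyMinimal] (hWeq : W = (⟨0, 0, 0, (-2646), 74088⟩ : WeierstrassCurve ℚ)) (hr : W.analyticRank = 0)
    {c : absoluteGaloisGroup ℚ} (hc : IsComplexConjugation (Rat.castHom ℝ) c)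
    (hord : ∀ κE : ZpExtension ↥(fixedField (Subgroup.zpowers (absRestrictNormalHom (W.divisionField 3) c))) 3,
      κE.IsCyclotomic → classNumberPExp κE (1 + 1) = classNumberPExp κE 1)
    (hqrk : haveI : NumberField ↥(W.divisionField 3) := NumberField.mk
      ∀ K : IntermediateField ℚ ↥(W.divisionField 3), Module.finrank ℚ ↥K = 2 →
        ¬ K ≤ fixedField (Subgroup.zpowers (absRestrictNormalHom (W.divisionField 3) c)) →
        ∀ κE : ZpExtension ↥K 3, κE.IsCyclotomic → classGroupPRank κE (1 + 1) = classGroupPRank κE 1) :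
    MissingUpperBoundAt W 3 := by
  subst hWeq
  haveI : Fact (Nat.Prime 3) := ⟨Nat.prime_three⟩
  exact CartanMuRoadQuadraticDoors.missingUpperBoundAt_three_wild_of_hasSplitCartanNormalizerModPImage_of_realSuccEqAt_of_quadRankSuccEqAt _ hKatoA hGZK hmod
    hr classO6_g338688dh1_3 irr_g338688dh1_3 hasSplitCartanNormalizerModPImage_g338688dh1_3 hc 1 hord 1 hqrk

/-! ### `338688e1` @ `p = 3` — source record `missingUpperBoundAt_g338688e1_3_fkK12` (`…WildUpperMuRoadThreeFukudaRecords30`; displays `hFW`): `K⁺ = ℚ(E[3])^c`, Fukuda at layers `(1,2)`,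
`ord₃ h(K⁺_2) = ord₃ h(K⁺_1)` (its kit evidence quoted there). Quadratic subfields of `ℚ(E[3])` (kit j327496): `D ∈ [-8, -3, 24]`; imaginary: `ℚ(√-8)`: `h = 1`, `3` SPLIT (`kron = 1`), `ord₃ h` at layers 0,1,2 = `[0, 1, 2]`, `rank₃` = `[0, 1, 1]` (`K₁ = x^6 + 12*x^4 + 36*x^2 + 8`, `Cl(K₁) ≅ [3]`; `K₂` of degree 18, `Cl(K₂) ≅ [333]`; bnfcertify 1/1/1): `rank₃` at layers (1,2): `1 = 1` (at (0,1) it FAILS: `0 ≠ 1`); `ℚ(√−3)`: `K₁ = ℚ(ζ₉)`, `K₂ = ℚ(ζ₂₇)`: `h = 1`, `1` (bnfcertify 1/1, kit j327832; also Iwasawa 1956 from `h(ℚ(√−3)) = 1`, `3` totally ramified), `rank₃` at layers (1,2): `0 = 0`. -/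

/-- **(A) AT `(338688e1, 3)` — NO NAMED FACT** (Ferrero–Washington REMOVED): from `ord₃ h(K⁺_2) = ord₃ h(K⁺_1)` on `K⁺ = ℚ(E[3])^c` (`hord`, the source record's datum) and `hqrk`
(`m = 1`; kit j327496, bnfcertify throughout), kernel `irr_g338688e1_3`, `hasSplitCartanNormalizerModPImage_g338688e1_3`; door
`CartanMuRoadQuadraticDoors.conjA_three_of_hasSplitCartanNormalizerModPImage_of_realSuccEqAt_of_quadRankSuccEqAt` (k8t-c4 g23). Per row; nothing booked.
[cite: Fukuda1994, Thm. 1, p. 264] [cite: CoatesSujatha2005, Thm. 3.4 (§3)] [cite: Serre1972, §2.2, §2.4 Prop. 15] [cite: Cremona2006, Table 1 (Cremona label 338688e1)] -/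
theorem conjA_g338688e1_3_fkK12Quad
    {W : WeierstrassCurve ℚ} [W.IsElliptic] (hWeq : W = (⟨0, 0, 0, (-10584), (-592704)⟩ : WeierstrassCurve ℚ))
    {c : absoluteGaloisGroup ℚ} (hc : IsComplexConjugation (Rat.castHom ℝ) c)
    (hord : ∀ κE : ZpExtension ↥(fixedField (Subgroup.zpowers (absRestrictNormalHom (W.divisionField 3) c))) 3,
      κE.IsCyclotomic → classNumberPExp κE (1 + 1) = classNumberPExp κE 1)
    (hqrk : haveI : NumberField ↥(W.divisionField 3) := NumberField.mk
      ∀ K : IntermediateField ℚ ↥(W.divisionField 3), Module.finrank ℚ ↥K = 2 →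
        ¬ K ≤ fixedField (Subgroup.zpowers (absRestrictNormalHom (W.divisionField 3) c)) →
        ∀ κE : ZpExtension ↥K 3, κE.IsCyclotomic → classGroupPRank κE (1 + 1) = classGroupPRank κE 1)
    (κ : ZpExtension ℚ 3) (hκ : κ.IsCyclotomic) :
    ∃ (γ : absoluteGaloisGroup ℚ) (Df : W.FineSelmerDualData κ γ),
      Module.Finite ℤ_[3] (RestrictScalars ℤ_[3] (IwasawaAlgebra 3) Df.X) := by
  subst hWeq
  exact CartanMuRoadQuadraticDoors.conjA_three_of_hasSplitCartanNormalizerModPImage_of_realSuccEqAt_of_quadRankSuccEqAt _ irr_g338688e1_3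
    hasSplitCartanNormalizerModPImage_g338688e1_3 hc 1 hord 1 hqrk κ hκ

/-- **RECORD — U₀ `ord₃ #Ш(E) ≤ ord₃ #Ш(E)_an` for `E = 338688e1` at `p = 3` with Ferrero–Washington REMOVED**: named facts `hKatoA hGZK hmod` ONLY; displayed:
Cremona's `r_an = 0`, the source record's `K⁺` datum `hord` (ord₃ h(K⁺_2) = ord₃ h(K⁺_1), layers `(1,2)`), and `hqrk` (`m = 1`, kit j327496); kernel `classO6_g338688e1_3`, `irr_g338688e1_3`,
`hasSplitCartanNormalizerModPImage_g338688e1_3`; door `…missingUpperBoundAt_three_wild_of_hasSplitCartanNormalizerModPImage_of_realSuccEqAt_of_quadRankSuccEqAt`.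
Supersedes `missingUpperBoundAt_g338688e1_3_fkK12NoF` (which displays `hFW`). Per row; nothing booked; BSD proved for no curve.
[cite: Kato2004Asterisque, Thm. 14.5 (3) (p. 236)] [cite: Fukuda1994, Thm. 1, p. 264] [cite: CoatesSujatha2005, Thm. 3.4 (§3)] [cite: Cremona2006, Table 1 (Cremona label 338688e1)] -/
theorem missingUpperBoundAt_g338688e1_3_fkK12Quad
    (hKatoA : Kato2004.rankZero_padicValNat_sha_add_padicValNat_tamagawa_le_of_additive_potGood_of_irreducible_of_fineSelmerDual_fg)
    (hGZK : rank_eq_analyticRank_of_analyticRank_le_one) (hmod : hasEntireLFunction_rat)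
    {W : WeierstrassCurve ℚ} [W.IsElliptic] [W.IsGloballyMinimal] (hWeq : W = (⟨0, 0, 0, (-10584), (-592704)⟩ : WeierstrassCurve ℚ)) (hr : W.analyticRank = 0)
    {c : absoluteGaloisGroup ℚ} (hc : IsComplexConjugation (Rat.castHom ℝ) c)
    (hord : ∀ κE : ZpExtension ↥(fixedField (Subgroup.zpowers (absRestrictNormalHom (W.divisionField 3) c))) 3,
      κE.IsCyclotomic → classNumberPExp κE (1 + 1) = classNumberPExp κE 1)
    (hqrk : haveI : NumberField ↥(W.divisionField 3) := NumberField.mk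
      ∀ K : IntermediateField ℚ ↥(W.divisionField 3), Module.finrank ℚ ↥K = 2 →
        ¬ K ≤ fixedField (Subgroup.zpowers (absRestrictNormalHom (W.divisionField 3) c)) →
        ∀ κE : ZpExtension ↥K 3, κE.IsCyclotomic → classGroupPRank κE (1 + 1) = classGroupPRank κE 1) :
    MissingUpperBoundAt W 3 := by
  subst hWeq
  haveI : Fact (Nat.Prime 3) := ⟨Nat.prime_three⟩
  exact CartanMuRoadQuadraticDoors.missingUpperBoundAt_three_wild_of_hasSplitCartanNormalizerModPImage_of_realSuccEqAt_of_quadRankSuccEqAt _ hKatoA hGZK hmod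
    hr classO6_g338688e1_3 irr_g338688e1_3 hasSplitCartanNormalizerModPImage_g338688e1_3 hc 1 hord 1 hqrk

end Summit.BirchSwinnertonDyer.BirchSwinnertonDyer.Theorems.WildUpperUnitTwistRecords

end
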